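import Literature.Probability.RandomPlanarGeometry.SAWCountZdSymbolSplitRun
import Literature.Probability.RandomPlanarGeometry.SAWCountZdSymbolSecondCoefficient
import HarnessLib

/-!
# THE SECOND-LAYER TOP CENSUS: `U'_j = (2j−4)(4j−7)(2j−5)‼·2^{2j−3}` for every `j ≥ 3` — five-runs plus split runs

Topic `Literature/Probability/RandomPlanarGeometry` (the «SYMBOL POLYNOMIALITY» programme, second layer; on `SAWCountZdSymbolFiveRun.lean` (a-p1 g26: `fiveVec`,
`card_shapeClass_fiveVec = (2j−5)‼2^{2j−1}`, `mem_shapeClass_iff`), `SAWCountZdSymbolSplitRun.lean` (a-p1 g26: `SepAdj`, `splitVec`, the additive split count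
`card_shapeClass_splitVec`), `SAWCountZdSymbolSecondCoefficient.lean` (a-p1 g26: `secondShapeSumTop`), η `four_le_of_zero_block`, the block sums `bsumW_ne_zero_of_odd`).

PRINTED CONTEXT (locators only; nothing is quoted digit-for-digit). Madras–Slade (1993) §1.1 eq. (1.1.8) p. 5, Definition 1.2.4, §1.2 p. 10; Clisby–Liang–Slade (2007)
§3.3 eqs. (29)/(31). NOT IN PRINT as far as the lane's desks could locate: the statements below.

THE THEOREM. `U'_j = secondShapeSumTop j = Σ_{A valid on 2j letters, breaks A = 2j−4} #shapeClass_j(2j, A)`. ★ `exists_eq_fiveVec_or_splitVec`: a valid vector with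
`m − 4` breaks (four adjacencies) and a non-empty class is a FIVE-RUN vector `fiveVec m s` or a SPLIT vector `splitVec m i q` (the zero block has length exactly four and
carries three consecutive adjacencies; the fourth extends the run or is separated); the split vectors are indexed injectively by the off-diagonal pairs `(a, b)` of run
slots `< m − 4` (`splitIdx`: the pair run before or after the block), `(m−4)(m−5)` of them, the five-runs by `s < m − 4`; the two families are disjoint
(`fiveVec_ne_splitVec`). Summing the class counts of the two previous files: ★★★ **`secondShapeSumTop_eq : U'_j = (2j−4)(4j−7)(2j−5)‼·2^{2j−3}` for every `j ≥ 3`**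
(`(2j−4)·(2j−5)‼2^{2j−1} + (2j−4)(2j−5)·[(2j−5)‼2^{2j−2} − (2j−7)‼2^{2j−3}]`; `secondTop_arith`). The lane's census values `U'_4 = 3456`, `U'_5 = 149760`, `U'_6 = 7311360`
(tree), `U'_7 = 406425600` (kit j291072) and the BLIND cell BQ-3 `U'_8 = 25 546 752 000` («Am. BQ») are instances; this is the first conjunct of `SecondLayerSums j`
(`SAWCountZdSymbolSecondCancellation.lean`), the second being `SAWCountZdSymbolSecondLowerCount.three_mul_secondShapeSumBelow`.
Tool notion (the lane's): `splitIdx`.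

THIS FILE (lane «pcv-sawmu», a-p1 g26; all PROVED, standard axioms): `splitIdx`, `splitIdx_sepAdj`, `splitIdx_inj`, `fiveVec_inj`, `splitVec_inj`, `fiveVec_ne_splitVec`,
★ `exists_eq_fiveVec_or_splitVec`, `secondTop_arith` (private), ★★★ `secondShapeSumTop_eq`.
[cite: MadrasSlade1993, §1.1 eq. (1.1.8) p. 5; Definition 1.2.4; §1.2 (p. 10)] [cite: ClisbyLiangSlade2007, §3.3 eqs. (29)/(31)]

Provenance: lane «pcv-sawmu», a-p1 g26 (2026-08-28).
-/

open Finset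
open scoped BigOperators
open Literature.Probability.LatticeModels
open Literature.Probability.RandomPlanarGeometry.SAW
open Literature.Probability.Percolation

namespace Literature.Probability.RandomPlanarGeometry.SAW.Zd

namespace WordTypes

variable {m : ℕ}

/-! ### The index of the split vectors: ordered pairs of distinct run slots -/

/-- From an ordered pair `(a, b)` of distinct run slots to the split data `(i, q)`: the pair run before the block (`b < a`: `q = b`, `i = a + 1`) or after it
(`a < b`: `i = a`, `q = b + 3`). [cite: MadrasSlade1993, Definition 1.2.4; lane tool notion] -/
def splitIdx (ab : ℕ × ℕ) : ℕ × ℕ := if ab.2 < ab.1 then (ab.1 + 1, ab.2) else (ab.1, ab.2 + 3)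

/-- The split data of an off-diagonal pair of slots is a valid separated configuration. [cite: MadrasSlade1993, Definition 1.2.4; lane plumbing] -/
theorem splitIdx_sepAdj {ab : ℕ × ℕ} (hab : ab ∈ (Finset.range (m - 4)).offDiag) :
    (splitIdx ab).1 + 4 ≤ m ∧ SepAdj m (splitIdx ab).1 (splitIdx ab).2 := by
  rw [Finset.mem_offDiag, Finset.mem_range, Finset.mem_range] at hab
  obtain ⟨ha, hb, hne⟩ := hab
  unfold splitIdx SepAdj
  split_ifs with h <;> simp only <;> omega

/-- `splitIdx` is injective on the off-diagonal pairs. [cite: MadrasSlade1993, Definition 1.2.4; lane plumbing] -/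
theorem splitIdx_inj {ab ab' : ℕ × ℕ} (hab : ab ∈ (Finset.range (m - 4)).offDiag) (hab' : ab' ∈ (Finset.range (m - 4)).offDiag)
    (h : splitIdx ab = splitIdx ab') : ab = ab' := by
  rw [Finset.mem_offDiag, Finset.mem_range, Finset.mem_range] at hab hab'
  unfold splitIdx at h
  obtain ⟨a, b⟩ := ab
  obtain ⟨a', b'⟩ := ab'
  simp only at h hab hab' ⊢
  split_ifs at h with h1 h2 h2 <;> simp only [Prod.mk.injEq] at h ⊢ <;> omega

/-! ### Evaluations: injectivity and disjointness of the two families -/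

/-- `fiveVec m` is injective on `s + 5 ≤ m`. [cite: MadrasSlade1993, Definition 1.2.4; lane plumbing] -/
theorem fiveVec_inj {s s' : ℕ} (hs : s + 5 ≤ m) (hs' : s' + 5 ≤ m) (h : fiveVec m s = fiveVec m s') : s = s' := by
  have h1 : fiveVec m s' ⟨s, by omega⟩ = true := by rw [← h, fiveVec_eq_true_iff]; simp
  have h2 : fiveVec m s ⟨s', by omega⟩ = true := by rw [h, fiveVec_eq_true_iff]; simp
  rw [fiveVec_eq_true_iff] at h1 h2
  simp only at h1 h2
  omega

/-- `splitVec m` is injective on valid separated data. [cite: MadrasSlade1993, Definition 1.2.4; lane plumbing] -/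
theorem splitVec_inj {i q i' q' : ℕ} (hi : i + 4 ≤ m) (hq : SepAdj m i q) (hi' : i' + 4 ≤ m) (hq' : SepAdj m i' q')
    (h : splitVec m i q = splitVec m i' q') : i = i' ∧ q = q' := by
  unfold SepAdj at hq hq'
  have e : ∀ (x : ℕ) (hx : x < m), ((i ≤ x ∧ x ≤ i + 2) ∨ x = q) ↔ ((i' ≤ x ∧ x ≤ i' + 2) ∨ x = q') := by
    intro x hx
    rw [← splitVec_eq_true_iff (m := m) ⟨x, hx⟩, ← splitVec_eq_true_iff (m := m) ⟨x, hx⟩, h]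
  have e1 := e i (by omega); have e2 := e (i + 1) (by omega); have e3 := e (i + 2) (by omega); have e4 := e q (by omega)
  have e5 := e i' (by omega); have e6 := e (i' + 1) (by omega); have e7 := e (i' + 2) (by omega); have e8 := e q' (by omega)
  omega

/-- A five-run vector is never a split vector. [cite: MadrasSlade1993, Definition 1.2.4; lane plumbing] -/
theorem fiveVec_ne_splitVec {s i q : ℕ} (hi : i + 4 ≤ m) (hq : SepAdj m i q) : fiveVec m s ≠ splitVec m i q := by
  intro h
  unfold SepAdj at hq
  have e : ∀ (x : ℕ) (hx : x < m), (s ≤ x ∧ x ≤ s + 3) ↔ ((i ≤ x ∧ x ≤ i + 2) ∨ x = q) := by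
    intro x hx
    rw [← splitVec_eq_true_iff (m := m) ⟨x, hx⟩, ← fiveVec_eq_true_iff (m := m) ⟨x, hx⟩, h]
  have e1 := e i (by omega); have e2 := e (i + 2) (by omega); have e3 := e q (by omega)
  omega

/-! ### ★ Classification of the four-adjacency vectors with a non-empty class -/

/-- ★ A valid adjacency vector with `m − 4` breaks and a non-empty class is a five-run vector or a split vector: the zero block (length exactly four)
carries three consecutive adjacencies, and the fourth one either extends the run or is separated. [cite: MadrasSlade1993, Definition 1.2.4; lane lemma] -/
theorem exists_eq_fiveVec_or_splitVec {j : ℕ} {A : Fin m → Bool} (hb : breaks A + 4 = m) (hv : AdjValid A) {κ : Word m m}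
    (hκ : κ ∈ shapeClass j m A) :
    (∃ s, s + 5 ≤ m ∧ A = fiveVec m s) ∨ (∃ ab ∈ (Finset.range (m - 4)).offDiag, A = splitVec m (splitIdx ab).1 (splitIdx ab).2) := by
  classical
  rw [mem_shapeClass_iff] at hκ
  obtain ⟨-, -, -, hnr, a, a', haa', ha', hA, hpos⟩ := hκ
  have h4 := four_le_of_zero_block _ κ hnr haa' ha' hA hpos
  -- the true set has four elements and contains `a, a+1, a+2`
  set T := Finset.univ.filter fun k : Fin m => A k = true with hT
  have hsum := Finset.card_filter_add_card_filter_not (s := (Finset.univ : Finset (Fin m))) (fun k : Fin m => A k = false)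
  simp only [Finset.card_univ, Fintype.card_fin, Bool.not_eq_false] at hsum
  have hT4 : T.card = 4 := by unfold breaks at hb; rw [hT]; omega
  have hmemT : ∀ x : Fin m, x ∈ T ↔ A x = true := fun x => by rw [hT, Finset.mem_filter]; simp
  have ht0 : A ⟨a, by omega⟩ = true := hA _ le_rfl (by simp only; omega)
  have ht1 : A ⟨a + 1, by omega⟩ = true := hA _ (by simp only; omega) (by simp only; omega)
  have ht2 : A ⟨a + 2, by omega⟩ = true := hA _ (by simp only; omega) (by simp only; omega)
  -- the block has length exactly four
  have hz : bsumW κ a a' = 0 := (wordPos_eq_iff_bsumW κ haa'.le ha').1 hpos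
  have hlast : A ⟨m - 1, by omega⟩ = false := hv (by omega)
  have ha4 : a' = a + 4 := by
    by_contra hne
    rcases Nat.lt_or_ge a' (a + 6) with hlt | hge
    · -- length 5: odd
      have h5 : a' = a + 5 := by omega
      exact bsumW_ne_zero_of_odd κ ha' (by rw [h5]; omega) hz
    · -- length ≥ 6: five adjacencies
      have ht3 : A ⟨a + 3, by omega⟩ = true := hA _ (by simp only; omega) (by simp only; omega)
      have ht4 : A ⟨a + 4, by omega⟩ = true := hA _ (by simp only; omega) (by simp only; omega)
      have hsub : ({⟨a, by omega⟩, ⟨a + 1, by omega⟩, ⟨a + 2, by omega⟩, ⟨a + 3, by omega⟩, ⟨a + 4, by omega⟩} : Finset (Fin m)) ⊆ T := by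
        intro x hx
        simp only [Finset.mem_insert, Finset.mem_singleton] at hx
        rcases hx with rfl | rfl | rfl | rfl | rfl
        · exact (hmemT _).2 ht0
        · exact (hmemT _).2 ht1
        · exact (hmemT _).2 ht2
        · exact (hmemT _).2 ht3
        · exact (hmemT _).2 ht4
      have := Finset.card_le_card hsub
      rw [Finset.card_insert_of_notMem (by simp [Fin.ext_iff]), Finset.card_insert_of_notMem (by simp [Fin.ext_iff]),
        Finset.card_insert_of_notMem (by simp [Fin.ext_iff]), Finset.card_pair (by simp [Fin.ext_iff]), hT4] at this
      omega
  subst ha4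
  -- the fourth adjacency `t`
  set S3 : Finset (Fin m) := {⟨a, by omega⟩, ⟨a + 1, by omega⟩, ⟨a + 2, by omega⟩} with hS3
  have hS3T : S3 ⊆ T := by
    intro x hx
    rw [hS3] at hx
    simp only [Finset.mem_insert, Finset.mem_singleton] at hx
    rcases hx with rfl | rfl | rfl
    · exact (hmemT _).2 ht0
    · exact (hmemT _).2 ht1
    · exact (hmemT _).2 ht2
  have hS3c : S3.card = 3 := by
    rw [hS3, Finset.card_insert_of_notMem (by simp [Fin.ext_iff]), Finset.card_pair (by simp [Fin.ext_iff])]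
  have hdiff : (T \ S3).card = 1 := by rw [Finset.card_sdiff_of_subset hS3T, hT4, hS3c]
  obtain ⟨t, ht⟩ := Finset.card_eq_one.1 hdiff
  have htT : t ∈ T ∧ t ∉ S3 := by rw [← Finset.mem_sdiff, ht]; exact Finset.mem_singleton_self _
  have hTeq : ∀ x : Fin m, x ∈ T ↔ x ∈ S3 ∨ x = t := by
    intro x
    constructor
    · intro hx
      by_cases hxS : x ∈ S3
      · exact Or.inl hxS
      · right; have : x ∈ T \ S3 := Finset.mem_sdiff.2 ⟨hx, hxS⟩; rw [ht] at this; exact Finset.mem_singleton.1 this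
    · rintro (hx | rfl)
      · exact hS3T hx
      · exact htT.1
  -- the characterisation of `A`
  have hAiff : ∀ x : Fin m, A x = true ↔ (a ≤ x.val ∧ x.val ≤ a + 2) ∨ x.val = t.val := by
    intro x
    rw [← hmemT x, hTeq x, hS3]
    simp only [Finset.mem_insert, Finset.mem_singleton, Fin.ext_iff]
    omega
  have htS3 : ¬ (a ≤ t.val ∧ t.val ≤ a + 2) := by
    intro h; apply htT.2; rw [hS3]; simp only [Finset.mem_insert, Finset.mem_singleton, Fin.ext_iff]; omega
  have htm : t.val + 2 ≤ m := by
    by_contra h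
    have heq : t = ⟨m - 1, by omega⟩ := Fin.ext (by simp only; omega)
    have := (hmemT t).1 htT.1
    rw [heq, hlast] at this
    exact Bool.false_ne_true this
  -- the three cases for `t`
  by_cases h3 : t.val = a + 3
  · left
    refine ⟨a, by omega, funext fun x => ?_⟩
    rw [Bool.eq_iff_iff, hAiff, fiveVec_eq_true_iff]
    omega
  by_cases h1 : t.val + 1 = a
  · left
    refine ⟨a - 1, by omega, funext fun x => ?_⟩
    rw [Bool.eq_iff_iff, hAiff, fiveVec_eq_true_iff]
    omega
  · right
    have hsep : t.val + 2 ≤ a ∨ a + 4 ≤ t.val := by omega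
    rcases hsep with hlt | hgt
    · refine ⟨(a - 1, t.val), ?_, ?_⟩
      · rw [Finset.mem_offDiag, Finset.mem_range, Finset.mem_range]; simp only; omega
      · have hidx : splitIdx (a - 1, t.val) = (a, t.val) := by
          unfold splitIdx
          split_ifs with h
          · exact Prod.ext (by simp only; omega) rfl
          · exfalso; simp only at h; omega
        rw [hidx]
        funext x
        rw [Bool.eq_iff_iff, hAiff, splitVec_eq_true_iff]
    · refine ⟨(a, t.val - 3), ?_, ?_⟩
      · rw [Finset.mem_offDiag, Finset.mem_range, Finset.mem_range]; simp only; omega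
      · have hidx : splitIdx (a, t.val - 3) = (a, t.val) := by
          unfold splitIdx
          split_ifs with h
          · exfalso; simp only at h; omega
          · exact Prod.ext rfl (by simp only; omega)
        rw [hidx]
        funext x
        rw [Bool.eq_iff_iff, hAiff, splitVec_eq_true_iff]

/-! ### ★★★ The second-layer top census -/

/-- The arithmetic of the top census: `(4j−7)D + (2j−5)E = 4D + 2(2j−5)D` with `D = (2j−5)‼`, `E = (2j−7)‼` (`j ≥ 3`).
[cite: MadrasSlade1993, Definition 1.2.4; lane plumbing] -/
private theorem secondTop_arith (j : ℕ) (hj : 3 ≤ j) :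
    (4 * j - 7) * (2 * j - 5).doubleFactorial + (2 * j - 5) * (2 * j - 7).doubleFactorial =
      4 * (2 * j - 5).doubleFactorial + 2 * (2 * j - 5) * (2 * j - 5).doubleFactorial := by
  rcases Nat.lt_or_ge j 4 with h | h
  · have : j = 3 := by omega
    subst this; decide
  · obtain ⟨k, rfl⟩ : ∃ k, j = k + 4 := ⟨j - 4, by omega⟩
    have e1 : 2 * (k + 4) - 5 = 2 * k + 1 + 2 := by omega
    have e2 : 2 * (k + 4) - 7 = 2 * k + 1 := by omega
    have e3 : 4 * (k + 4) - 7 = 4 * k + 9 := by omega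
    rw [e1, e2, e3, Nat.doubleFactorial_add_two]
    ring

open Classical in
/-- ★★★ THE SECOND-LAYER TOP CENSUS FOR EVERY `j ≥ 3`: `U'_j = secondShapeSumTop j = (2j−4)(4j−7)(2j−5)‼·2^{2j−3}` — the classes on `2j` letters with four
adjacencies are the `2j − 4` five-run classes (`(2j−5)‼2^{2j−1}` each, `SAWCountZdSymbolFiveRun`) and the `(2j−4)(2j−5)` split classes (`(2j−5)‼2^{2j−2} − (2j−7)‼2^{2j−3}`
each, `SAWCountZdSymbolSplitRun`). The lane's census values `U'_4 = 3456`, `U'_5 = 149760`, `U'_6 = 7311360` (tree `shM_eq_lit`), `U'_7 = 406425600` (kit j291072) and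
the BLIND cell BQ-3 `U'_8 = 25 546 752 000` (register «Am. BQ») are its instances; this is the first conjunct of `SecondLayerSums j` of
`SAWCountZdSymbolSecondCancellation.lean`. [cite: MadrasSlade1993, §1.1 eq. (1.1.8) p. 5; Definition 1.2.4] [cite: ClisbyLiangSlade2007, §3.3 eqs. (29)/(31); lane theorem] -/
theorem secondShapeSumTop_eq (j : ℕ) (hj : 3 ≤ j) :
    secondShapeSumTop j = (2 * j - 4) * (4 * j - 7) * ((2 * j - 5).doubleFactorial * 2 ^ (2 * j - 3)) := by
  unfold secondShapeSumTop
  set f : (Fin (2 * j) → Bool) → ℕ := fun A => if AdjValid A ∧ breaks A = 2 * j - 4 then (shapeClass j (2 * j) A).card else 0 with hf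
  set I5 := (Finset.range ((2 * j) - 4)).image (fiveVec (2 * j)) with hI5
  set I42 := ((Finset.range ((2 * j) - 4)).offDiag).image (fun ab => splitVec (2 * j) (splitIdx ab).1 (splitIdx ab).2) with hI42
  -- every other vector contributes nothing
  have hvan : ∀ A ∈ (Finset.univ : Finset (Fin (2 * j) → Bool)), A ∉ I5 ∪ I42 → f A = 0 := by
    intro A _ hA
    rw [hf]; simp only
    split_ifs with h
    · by_contra hne
      obtain ⟨κ, hκ⟩ := Finset.card_pos.1 (Nat.pos_of_ne_zero hne)
      rcases exists_eq_fiveVec_or_splitVec (by rw [h.2]; omega) h.1 hκ with ⟨s, hs, rfl⟩ | ⟨ab, hab, rfl⟩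
      · exact hA (Finset.mem_union_left _ (Finset.mem_image.2 ⟨s, Finset.mem_range.2 (by omega), rfl⟩))
      · exact hA (Finset.mem_union_right _ (Finset.mem_image.2 ⟨ab, hab, rfl⟩))
    · rfl
  have hdisj : Disjoint I5 I42 := by
    rw [Finset.disjoint_left]
    intro A h5 h42
    obtain ⟨s, hs, rfl⟩ := Finset.mem_image.1 h5
    obtain ⟨ab, hab, heq⟩ := Finset.mem_image.1 h42
    rw [Finset.mem_range] at hs
    obtain ⟨hi, hsep⟩ := splitIdx_sepAdj hab
    exact fiveVec_ne_splitVec hi hsep heq.symm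
  have hinj5 : Set.InjOn (fiveVec (2 * j)) ↑(Finset.range ((2 * j) - 4)) := by
    intro s hs s' hs' h
    rw [Finset.mem_coe, Finset.mem_range] at hs hs'
    exact fiveVec_inj (by omega) (by omega) h
  have hinj42 : Set.InjOn (fun ab => splitVec (2 * j) (splitIdx ab).1 (splitIdx ab).2) ↑((Finset.range ((2 * j) - 4)).offDiag) := by
    intro ab hab ab' hab' h
    rw [Finset.mem_coe] at hab hab'
    obtain ⟨hi, hsep⟩ := splitIdx_sepAdj hab
    obtain ⟨hi', hsep'⟩ := splitIdx_sepAdj hab'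
    obtain ⟨h1, h2⟩ := splitVec_inj hi hsep hi' hsep' h
    exact splitIdx_inj hab hab' (Prod.ext h1 h2)
  -- the values on the two families
  have hval5 : ∀ s ∈ Finset.range ((2 * j) - 4), f (fiveVec (2 * j) s) = (2 * j - 5).doubleFactorial * 2 ^ (2 * j - 1) := by
    intro s hs
    rw [Finset.mem_range] at hs
    rw [hf]; simp only
    rw [if_pos ⟨adjValid_fiveVec (by omega), (breaks_fiveVec (by omega)).trans (by omega)⟩, card_shapeClass_fiveVec (by omega)]
  have hval42 : ∀ ab ∈ (Finset.range ((2 * j) - 4)).offDiag,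
      f (splitVec (2 * j) (splitIdx ab).1 (splitIdx ab).2) + (2 * j - 7).doubleFactorial * 2 ^ (2 * j - 3) = (2 * j - 5).doubleFactorial * 2 ^ (2 * j - 2) := by
    intro ab hab
    obtain ⟨hi, hsep⟩ := splitIdx_sepAdj hab
    rw [hf]; simp only
    rw [if_pos ⟨adjValid_splitVec hi hsep, (breaks_splitVec hi hsep).trans (by omega)⟩]
    exact card_shapeClass_splitVec hj hi hsep
  -- assemble
  have hcard : ((Finset.range ((2 * j) - 4)).offDiag).card = ((2 * j) - 4) * ((2 * j) - 5) := by
    rw [Finset.offDiag_card, Finset.card_range]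
    have h5 : (2 * j) - 4 = ((2 * j) - 5) + 1 := by omega
    rw [h5]
    exact Nat.sub_eq_of_eq_add (by ring)
  have step1 : ∑ A, f A = ∑ s ∈ Finset.range ((2 * j) - 4), f (fiveVec (2 * j) s) +
      ∑ ab ∈ (Finset.range ((2 * j) - 4)).offDiag, f (splitVec (2 * j) (splitIdx ab).1 (splitIdx ab).2) := by
    rw [← Finset.sum_subset (Finset.subset_univ _) hvan, Finset.sum_union hdisj, Finset.sum_image hinj5, Finset.sum_image hinj42]
  have step2 : ∑ s ∈ Finset.range ((2 * j) - 4), f (fiveVec (2 * j) s) = ((2 * j) - 4) * ((2 * j - 5).doubleFactorial * 2 ^ (2 * j - 1)) := by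
    rw [Finset.sum_congr rfl hval5, Finset.sum_const, Finset.card_range, smul_eq_mul]
  have step3 : ∑ ab ∈ (Finset.range ((2 * j) - 4)).offDiag, f (splitVec (2 * j) (splitIdx ab).1 (splitIdx ab).2) +
      ((2 * j) - 4) * ((2 * j) - 5) * ((2 * j - 7).doubleFactorial * 2 ^ (2 * j - 3)) = ((2 * j) - 4) * ((2 * j) - 5) * ((2 * j - 5).doubleFactorial * 2 ^ (2 * j - 2)) := by
    rw [← hcard, Finset.card_eq_sum_ones, Finset.sum_mul, Finset.sum_mul, ← Finset.sum_add_distrib]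
    refine Finset.sum_congr rfl fun ab hab => ?_
    rw [one_mul, one_mul]
    exact hval42 ab hab
  have hsum : ∑ A, f A + ((2 * j) - 4) * ((2 * j) - 5) * ((2 * j - 7).doubleFactorial * 2 ^ (2 * j - 3)) =
      ((2 * j) - 4) * ((2 * j - 5).doubleFactorial * 2 ^ (2 * j - 1)) + ((2 * j) - 4) * ((2 * j) - 5) * ((2 * j - 5).doubleFactorial * 2 ^ (2 * j - 2)) := by
    rw [step1, step2, add_assoc, step3]
  -- arithmetic
  have key := secondTop_arith j hj
  have h2 : 2 ^ (2 * j - 1) = 2 ^ (2 * j - 3) * 4 := by rw [show 2 * j - 1 = 2 * j - 3 + 2 by omega, pow_add]; norm_num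
  have h3 : 2 ^ (2 * j - 2) = 2 ^ (2 * j - 3) * 2 := by rw [show 2 * j - 2 = 2 * j - 3 + 1 by omega, pow_succ]
  rw [h2, h3] at hsum
  have htarget : (2 * j - 4) * (4 * j - 7) * ((2 * j - 5).doubleFactorial * 2 ^ (2 * j - 3)) +
      (2 * j - 4) * (2 * j - 5) * ((2 * j - 7).doubleFactorial * 2 ^ (2 * j - 3)) =
      (2 * j - 4) * ((2 * j - 5).doubleFactorial * (2 ^ (2 * j - 3) * 4)) + (2 * j - 4) * (2 * j - 5) * ((2 * j - 5).doubleFactorial * (2 ^ (2 * j - 3) * 2)) := by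
    have := congrArg (fun x => (2 * j - 4) * 2 ^ (2 * j - 3) * x) key
    simp only [mul_add] at this
    linarith [this]
  rw [show (∑ A, f A) = Finset.univ.sum f from rfl] at hsum
  show Finset.univ.sum f = _
  omega

end WordTypes

end Literature.Probability.RandomPlanarGeometry.SAW.Zd
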